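import Summits.Ventures.CertifiedQuantumChemistry.Rows.DifferenceDecisions
import Summits.Ventures.CertifiedQuantumChemistry.Rows.SpinSectors
import HarnessLib

/-!
# Ventures/CertifiedQuantumChemistry — Rows/ThreeTermDifferenceRows.lean: THREE-TERM difference rows
# `ΔE = E₀(H[F]; a, b) − E₀(H[G₁]; a₁, b₁) − E₀(H[G₂]; a₂, b₂)` (a BINDING / FRAGMENTATION energy against the
# ISOLATED-FRAGMENT sum) and the `dE3-from-absolutes` rule (width `W_F + W₁ + W₂`) — the «T3» typed form

HONEST FRAMING (verbatim): certified bounds for a stated model Hamiltonian in a stated basis; not a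
claim about the real molecule or material beyond that model. A three-term row is a statement about THREE
MODEL energies (three pinned files, three fixed sectors); whether the isolated-fragment sum is the right
reference for a given supermolecule model (basis, geometry, generator provenance, the float link δ_link) is
a VALIDATED census question of the chair / director (director-chem P22 (3) «designation rider»), never a
kernel statement.

WHY (director-chem g12 P22 (4), 2026-08-29T07:52Z, «TYPED FORM — two acceptable shapes … T3 (preferred by me,
fewest lemmas) = a 3-term key ΔE := E₀(5d2085ef; 10,9) − E₀(Ni⁺ file; 5,4) − E₀(N₂ file; 5,5) with the fragment
SECTORS FIXED by the chemistry (no min over splits, no factorisation lemma): needs only the difference-of-absolutes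
soundness extended to three brackets (interval arithmetic; the 2-term lemma's sibling)»): this file IS that sibling
of `Rows/DifferenceRows.lean` / `Rows/DifferenceDecisions.lean` — the same shapes with one more subtrahend:

* §1 the quantity `Model.energyDiff3` and the row predicates `Diff3LowerRow` / `Diff3UpperRow` / `Diff3Bracket`
  (explicit rational slots; the physical ranges of ALL THREE sectors are part of the row), `.le`, `.range`, `.mono`,
  `Diff3Bracket.lo_le_hi`;
* §2 the `dE3-from-absolutes` rule: `diff3LowerRow_of_rows` (`L_F − U₁ − U₂ ≤ ΔE`), `diff3UpperRow_of_rows`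
  (`ΔE ≤ U_F − L₁ − L₂`), `diff3Bracket_of_brackets`, the width identity `width3_from_absolutes`
  (`= W_F + W₁ + W₂`), and the MIXED forms from a certified TWO-TERM difference row plus ONE absolute bracket
  (`diff3LowerRow_of_diffLowerRow_upperRow`, `diff3UpperRow_of_diffUpperRow_lowerRow`, `diff3Bracket_of_diffBracket_bracket` —
  e.g. a `dE-direct` certificate on `F − G₁` composed with an exact bracket on the small fragment `G₂`);
* §3 DECISIONS: `Diff3LowerRow.lt_of_pos` (ΔE > 0: the supermolecule lies ABOVE the fragment sum — unbound in the
  models), `Diff3UpperRow.lt_of_neg` (ΔE < 0: BOUND in the models), `Diff3Bracket.sign_trichotomy` (reusing the slot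
  predicate `DiffBracket.StraddlesZero`), `Diff3Bracket.energyDiff3_mem_Icc`, `Diff3Bracket.abs_sub_midpoint_le` (+ the
  informative-width form with the slot predicate `IsInformativeWidth`), the threshold decision `Diff3Bracket.decides`;
* §4 the `N`-electron reading `Diff3Bracket.groundEnergy_mem_of_le_succ` (all three sectors nearly balanced);
* §5 the STEP-0 predicate `Diff3WidthBeatsAbsolutes` (a direct three-term certificate beats the absolutes iff its width
  is `< ½ (W_F + W₁ + W₂)`) and `not_diff3WidthBeatsAbsolutes_from_absolutes`.

WHAT THIS IS NOT: not a difference CERTIFICATE (every bracket here comes from rows certified elsewhere); not the TΣ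
form (ONE direct-sum supermolecule file and a min over the sector splits — NOT typed here); not a key grammar (the
`dE3@…` row-key syntax for three files is the chair's / referees' choice — a key ↔ records lemma in the
`Rows/ModelPinDiffKeys.lean` style is added beside the first three-term row once the grammar is fixed); nothing is
asserted unconditionally; no definition here has analytic content beyond subtraction. Typed by chem-type-07
(B8-1 slot 07, gen 13) as the answer «T3 is cheaper — and here it is» to P22 (4).
-/

noncomputable section

namespace Summit.Ventures.CertifiedQuantumChemistry

open Literature.MathematicalPhysics.QuantumLattice (groundEnergy)

variable {kF k₁ k₂ : ℕ}

/-! ## §1 The three-term quantity and its row predicates -/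

/-- THE CERTIFIED THREE-TERM QUANTITY of a pinned triple: `ΔE = E₀(H[F]; a, b) − E₀(H[G₁]; a₁, b₁) − E₀(H[G₂]; a₂, b₂)`
(e.g. a supermolecule `F` against its two ISOLATED fragments `G₁`, `G₂` in their chemistry-fixed sectors: a model
binding energy). Junk values off the physical ranges, as `Model.energy`; the rows carry all three ranges. -/
def Model.energyDiff3 (F : Model kF) (a b : ℕ) (G₁ : Model k₁) (a₁ b₁ : ℕ) (G₂ : Model k₂) (a₂ b₂ : ℕ) : ℝ :=
  F.energy a b - G₁.energy a₁ b₁ - G₂.energy a₂ b₂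

/-- THREE-TERM LOWER row: all three sectors exist and `(lo : ℝ) ≤ E₀(F; a, b) − E₀(G₁; a₁, b₁) − E₀(G₂; a₂, b₂)`. -/
def Diff3LowerRow (F : Model kF) (a b : ℕ) (G₁ : Model k₁) (a₁ b₁ : ℕ) (G₂ : Model k₂) (a₂ b₂ : ℕ) (lo : ℚ) : Prop :=
  (a ≤ kF ∧ b ≤ kF) ∧ (a₁ ≤ k₁ ∧ b₁ ≤ k₁) ∧ (a₂ ≤ k₂ ∧ b₂ ≤ k₂) ∧
    ((lo : ℚ) : ℝ) ≤ F.energy a b - G₁.energy a₁ b₁ - G₂.energy a₂ b₂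

/-- THREE-TERM UPPER row: all three sectors exist and `E₀(F; a, b) − E₀(G₁; a₁, b₁) − E₀(G₂; a₂, b₂) ≤ (hi : ℝ)`. -/
def Diff3UpperRow (F : Model kF) (a b : ℕ) (G₁ : Model k₁) (a₁ b₁ : ℕ) (G₂ : Model k₂) (a₂ b₂ : ℕ) (hi : ℚ) : Prop :=
  (a ≤ kF ∧ b ≤ kF) ∧ (a₁ ≤ k₁ ∧ b₁ ≤ k₁) ∧ (a₂ ≤ k₂ ∧ b₂ ≤ k₂) ∧
    F.energy a b - G₁.energy a₁ b₁ - G₂.energy a₂ b₂ ≤ ((hi : ℚ) : ℝ)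

/-- Two-sided THREE-TERM row (certified bracket `[ΔE_L, ΔE_U]` of the three-term quantity) = lower ∧ upper. -/
def Diff3Bracket (F : Model kF) (a b : ℕ) (G₁ : Model k₁) (a₁ b₁ : ℕ) (G₂ : Model k₂) (a₂ b₂ : ℕ) (lo hi : ℚ) : Prop :=
  Diff3LowerRow F a b G₁ a₁ b₁ G₂ a₂ b₂ lo ∧ Diff3UpperRow F a b G₁ a₁ b₁ G₂ a₂ b₂ hi

variable {F : Model kF} {a b : ℕ} {G₁ : Model k₁} {a₁ b₁ : ℕ} {G₂ : Model k₂} {a₂ b₂ : ℕ} {lo hi : ℚ}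

/-- The three-term bracket is exactly the conjunction of the one-sided rows. -/
theorem diff3Bracket_iff :
    Diff3Bracket F a b G₁ a₁ b₁ G₂ a₂ b₂ lo hi ↔
      Diff3LowerRow F a b G₁ a₁ b₁ G₂ a₂ b₂ lo ∧ Diff3UpperRow F a b G₁ a₁ b₁ G₂ a₂ b₂ hi :=
  Iff.rfl

/-- The inequality of a three-term lower row, spelled with `Model.energyDiff3`. -/
theorem Diff3LowerRow.le (h : Diff3LowerRow F a b G₁ a₁ b₁ G₂ a₂ b₂ lo) :
    ((lo : ℚ) : ℝ) ≤ F.energyDiff3 a b G₁ a₁ b₁ G₂ a₂ b₂ :=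
  h.2.2.2

/-- The inequality of a three-term upper row, spelled with `Model.energyDiff3`. -/
theorem Diff3UpperRow.le (h : Diff3UpperRow F a b G₁ a₁ b₁ G₂ a₂ b₂ hi) :
    F.energyDiff3 a b G₁ a₁ b₁ G₂ a₂ b₂ ≤ ((hi : ℚ) : ℝ) :=
  h.2.2.2

/-- A three-term lower row lives on the physical ranges of ALL THREE sectors. -/
theorem Diff3LowerRow.range (h : Diff3LowerRow F a b G₁ a₁ b₁ G₂ a₂ b₂ lo) :
    (a ≤ kF ∧ b ≤ kF) ∧ (a₁ ≤ k₁ ∧ b₁ ≤ k₁) ∧ (a₂ ≤ k₂ ∧ b₂ ≤ k₂) :=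
  ⟨h.1, h.2.1, h.2.2.1⟩

/-- A three-term upper row lives on the physical ranges of ALL THREE sectors. -/
theorem Diff3UpperRow.range (h : Diff3UpperRow F a b G₁ a₁ b₁ G₂ a₂ b₂ hi) :
    (a ≤ kF ∧ b ≤ kF) ∧ (a₁ ≤ k₁ ∧ b₁ ≤ k₁) ∧ (a₂ ≤ k₂ ∧ b₂ ≤ k₂) :=
  ⟨h.1, h.2.1, h.2.2.1⟩

/-- A three-term lower row may be weakened downwards. -/
theorem Diff3LowerRow.mono {lo' : ℚ} (h : Diff3LowerRow F a b G₁ a₁ b₁ G₂ a₂ b₂ lo) (hle : lo' ≤ lo) :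
    Diff3LowerRow F a b G₁ a₁ b₁ G₂ a₂ b₂ lo' :=
  ⟨h.1, h.2.1, h.2.2.1, le_trans (by exact_mod_cast hle) h.2.2.2⟩

/-- A three-term upper row may be weakened upwards. -/
theorem Diff3UpperRow.mono {hi' : ℚ} (h : Diff3UpperRow F a b G₁ a₁ b₁ G₂ a₂ b₂ hi) (hle : hi ≤ hi') :
    Diff3UpperRow F a b G₁ a₁ b₁ G₂ a₂ b₂ hi' :=
  ⟨h.1, h.2.1, h.2.2.1, le_trans h.2.2.2 (by exact_mod_cast hle)⟩

/-- Consistency of a three-term bracket: `lo ≤ hi`. -/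
theorem Diff3Bracket.lo_le_hi (h : Diff3Bracket F a b G₁ a₁ b₁ G₂ a₂ b₂ lo hi) : lo ≤ hi := by
  have h' : ((lo : ℚ) : ℝ) ≤ ((hi : ℚ) : ℝ) := le_trans h.1.2.2.2 h.2.2.2.2
  exact_mod_cast h'

/-- The three-term quantity IS the two-term difference `E₀(F) − E₀(G₁)` minus the third energy (bookkeeping identity). -/
theorem Model.energyDiff3_eq_energyDiff_sub (F : Model kF) (a b : ℕ) (G₁ : Model k₁) (a₁ b₁ : ℕ) (G₂ : Model k₂) (a₂ b₂ : ℕ) :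
    F.energyDiff3 a b G₁ a₁ b₁ G₂ a₂ b₂ = F.energyDiff a b G₁ a₁ b₁ - G₂.energy a₂ b₂ :=
  rfl

/-! ## §2 The `dE3-from-absolutes` rule: interval arithmetic on three brackets -/

/-- **`ΔE_L = L_F − U₁ − U₂`**: a LOWER row for `F` and UPPER rows for `G₁`, `G₂` give the three-term lower row. -/
theorem diff3LowerRow_of_rows {loF hi₁ hi₂ : ℚ} (hF : LowerRow F a b loF) (h₁ : UpperRow G₁ a₁ b₁ hi₁)
    (h₂ : UpperRow G₂ a₂ b₂ hi₂) : Diff3LowerRow F a b G₁ a₁ b₁ G₂ a₂ b₂ (loF - hi₁ - hi₂) := by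
  refine ⟨hF.range, h₁.range, h₂.range, ?_⟩
  have e0 := hF.le
  have e1 := h₁.le
  have e2 := h₂.le
  push_cast
  linarith

/-- **`ΔE_U = U_F − L₁ − L₂`**: an UPPER row for `F` and LOWER rows for `G₁`, `G₂` give the three-term upper row. -/
theorem diff3UpperRow_of_rows {hiF lo₁ lo₂ : ℚ} (hF : UpperRow F a b hiF) (h₁ : LowerRow G₁ a₁ b₁ lo₁)
    (h₂ : LowerRow G₂ a₂ b₂ lo₂) : Diff3UpperRow F a b G₁ a₁ b₁ G₂ a₂ b₂ (hiF - lo₁ - lo₂) := by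
  refine ⟨hF.range, h₁.range, h₂.range, ?_⟩
  have e0 := hF.le
  have e1 := h₁.le
  have e2 := h₂.le
  push_cast
  linarith

/-- **THE `dE3-from-absolutes` RULE**: three certified absolute brackets give the certified three-term bracket
`[L_F − U₁ − U₂, U_F − L₁ − L₂]` (always valid; width `W_F + W₁ + W₂`). -/
theorem diff3Bracket_of_brackets {loF hiF lo₁ hi₁ lo₂ hi₂ : ℚ} (hF : Bracket F a b loF hiF)
    (h₁ : Bracket G₁ a₁ b₁ lo₁ hi₁) (h₂ : Bracket G₂ a₂ b₂ lo₂ hi₂) :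
    Diff3Bracket F a b G₁ a₁ b₁ G₂ a₂ b₂ (loF - hi₁ - hi₂) (hiF - lo₁ - lo₂) :=
  ⟨diff3LowerRow_of_rows hF.1 h₁.2 h₂.2, diff3UpperRow_of_rows hF.2 h₁.1 h₂.1⟩

/-- **The width of the `dE3-from-absolutes` bracket is the SUM of the three absolute widths** (an identity on the slots). -/
theorem width3_from_absolutes (loF hiF lo₁ hi₁ lo₂ hi₂ : ℚ) :
    (hiF - lo₁ - lo₂) - (loF - hi₁ - hi₂) = (hiF - loF) + (hi₁ - lo₁) + (hi₂ - lo₂) := by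
  ring

/-- MIXED form, lower side: a certified TWO-TERM difference lower row `lo ≤ E₀(F) − E₀(G₁)` (e.g. a `dE-direct`
certificate) and an UPPER row on the second fragment give the three-term lower row `lo − U₂`. -/
theorem diff3LowerRow_of_diffLowerRow_upperRow {lo' hi₂ : ℚ} (h : DiffLowerRow F a b G₁ a₁ b₁ lo')
    (h₂ : UpperRow G₂ a₂ b₂ hi₂) : Diff3LowerRow F a b G₁ a₁ b₁ G₂ a₂ b₂ (lo' - hi₂) := by
  refine ⟨h.range.1, h.range.2, h₂.range, ?_⟩
  have e0 := h.le
  have e2 := h₂.le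
  unfold Model.energyDiff at e0
  push_cast
  linarith

/-- MIXED form, upper side: `E₀(F) − E₀(G₁) ≤ hi` and a LOWER row on `G₂` give the three-term upper row `hi − L₂`. -/
theorem diff3UpperRow_of_diffUpperRow_lowerRow {hi' lo₂ : ℚ} (h : DiffUpperRow F a b G₁ a₁ b₁ hi')
    (h₂ : LowerRow G₂ a₂ b₂ lo₂) : Diff3UpperRow F a b G₁ a₁ b₁ G₂ a₂ b₂ (hi' - lo₂) := by
  refine ⟨h.range.1, h.range.2, h₂.range, ?_⟩
  have e0 := h.le
  have e2 := h₂.le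
  unfold Model.energyDiff at e0
  push_cast
  linarith

/-- MIXED form, two-sided: a two-term `DiffBracket` on `(F, G₁)` and an absolute `Bracket` on `G₂`. -/
theorem diff3Bracket_of_diffBracket_bracket {lo' hi' lo₂ hi₂ : ℚ} (h : DiffBracket F a b G₁ a₁ b₁ lo' hi')
    (h₂ : Bracket G₂ a₂ b₂ lo₂ hi₂) : Diff3Bracket F a b G₁ a₁ b₁ G₂ a₂ b₂ (lo' - hi₂) (hi' - lo₂) :=
  ⟨diff3LowerRow_of_diffLowerRow_upperRow h.1 h₂.2, diff3UpperRow_of_diffUpperRow_lowerRow h.2 h₂.1⟩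

/-! ## §3 What a three-term row DECIDES -/

/-- **UNBOUND IN THE MODELS**: a positive lower slot, `0 < lo ≤ ΔE`, certifies `E₀(G₁) + E₀(G₂) < E₀(F)` — the supermolecule's
sector energy lies strictly ABOVE the isolated-fragment sum. -/
theorem Diff3LowerRow.lt_of_pos (h : Diff3LowerRow F a b G₁ a₁ b₁ G₂ a₂ b₂ lo) (hlo : 0 < lo) :
    G₁.energy a₁ b₁ + G₂.energy a₂ b₂ < F.energy a b := by
  have h1 := h.le
  unfold Model.energyDiff3 at h1
  have h2 : (0 : ℝ) < ((lo : ℚ) : ℝ) := by exact_mod_cast hlo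
  linarith

/-- **BOUND IN THE MODELS**: a negative upper slot, `ΔE ≤ hi < 0`, certifies `E₀(F) < E₀(G₁) + E₀(G₂)` — the supermolecule's
sector energy lies strictly BELOW the isolated-fragment sum (a certified NEGATIVE model binding energy, by at least `|hi|`). -/
theorem Diff3UpperRow.lt_of_neg (h : Diff3UpperRow F a b G₁ a₁ b₁ G₂ a₂ b₂ hi) (hhi : hi < 0) :
    F.energy a b < G₁.energy a₁ b₁ + G₂.energy a₂ b₂ := by
  have h1 := h.le
  unfold Model.energyDiff3 at h1
  have h2 : ((hi : ℚ) : ℝ) < 0 := by exact_mod_cast hhi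
  linarith

/-- Two-sided forms of the sign decisions. -/
theorem Diff3Bracket.lt_of_pos (h : Diff3Bracket F a b G₁ a₁ b₁ G₂ a₂ b₂ lo hi) (hlo : 0 < lo) :
    G₁.energy a₁ b₁ + G₂.energy a₂ b₂ < F.energy a b :=
  h.1.lt_of_pos hlo

/-- Two-sided forms of the sign decisions. -/
theorem Diff3Bracket.lt_of_neg (h : Diff3Bracket F a b G₁ a₁ b₁ G₂ a₂ b₂ lo hi) (hhi : hi < 0) :
    F.energy a b < G₁.energy a₁ b₁ + G₂.energy a₂ b₂ :=
  h.2.lt_of_neg hhi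

/-- **SIGN TRICHOTOMY** on the slots of a certified three-term bracket: BOUND (`hi < 0`), UNBOUND (`0 < lo`), or the bracket
STRADDLES zero (`DiffBracket.StraddlesZero lo hi`, the slot predicate of `Rows/DifferenceDecisions.lean` — no sign decided). -/
theorem Diff3Bracket.sign_trichotomy (h : Diff3Bracket F a b G₁ a₁ b₁ G₂ a₂ b₂ lo hi) :
    F.energy a b < G₁.energy a₁ b₁ + G₂.energy a₂ b₂ ∨ G₁.energy a₁ b₁ + G₂.energy a₂ b₂ < F.energy a b ∨
      DiffBracket.StraddlesZero lo hi := by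
  by_cases hhi : hi < 0
  · exact Or.inl (h.lt_of_neg hhi)
  by_cases hlo : 0 < lo
  · exact Or.inr (Or.inl (h.lt_of_pos hlo))
  · exact Or.inr (Or.inr ⟨le_of_not_gt hlo, le_of_not_gt hhi⟩)

/-- The certified three-term quantity lies in the closed slot interval. -/
theorem Diff3Bracket.energyDiff3_mem_Icc (h : Diff3Bracket F a b G₁ a₁ b₁ G₂ a₂ b₂ lo hi) :
    F.energyDiff3 a b G₁ a₁ b₁ G₂ a₂ b₂ ∈ Set.Icc (((lo : ℚ)) : ℝ) (((hi : ℚ)) : ℝ) :=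
  ⟨h.1.le, h.2.le⟩

/-- Every certified `ΔE` lies within half the width of the bracket's midpoint: `|ΔE − (lo + hi)/2| ≤ (hi − lo)/2`. -/
theorem Diff3Bracket.abs_sub_midpoint_le (h : Diff3Bracket F a b G₁ a₁ b₁ G₂ a₂ b₂ lo hi) :
    |F.energyDiff3 a b G₁ a₁ b₁ G₂ a₂ b₂ - (((lo + hi) / 2 : ℚ) : ℝ)| ≤ (((hi - lo) / 2 : ℚ) : ℝ) := by
  have h1 := h.1.le
  have h2 := h.2.le
  rw [abs_le]
  push_cast
  constructor <;> linarith

/-- With an INFORMATIVE width (`hi − lo ≤ θ`, the slot predicate `IsInformativeWidth` of `Rows/DifferenceDecisions.lean`):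
`|ΔE − midpoint| ≤ θ/2`. -/
theorem Diff3Bracket.abs_sub_midpoint_le_of_informative (h : Diff3Bracket F a b G₁ a₁ b₁ G₂ a₂ b₂ lo hi) {θ : ℚ}
    (hθ : IsInformativeWidth lo hi θ) :
    |F.energyDiff3 a b G₁ a₁ b₁ G₂ a₂ b₂ - (((lo + hi) / 2 : ℚ) : ℝ)| ≤ ((θ / 2 : ℚ) : ℝ) := by
  refine (h.abs_sub_midpoint_le).trans ?_
  have hθ' : hi - lo ≤ θ := hθ
  exact_mod_cast (by linarith : (hi - lo) / 2 ≤ θ / 2)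

/-- **THRESHOLD DECISION**: a certified three-term bracket DECIDES `ΔE < τ` or `τ < ΔE` for every rational threshold `τ`
outside the slot interval. -/
theorem Diff3Bracket.decides (h : Diff3Bracket F a b G₁ a₁ b₁ G₂ a₂ b₂ lo hi) {τ : ℚ} (hτ : hi < τ ∨ τ < lo) :
    F.energyDiff3 a b G₁ a₁ b₁ G₂ a₂ b₂ < ((τ : ℚ) : ℝ) ∨ ((τ : ℚ) : ℝ) < F.energyDiff3 a b G₁ a₁ b₁ G₂ a₂ b₂ := by
  rcases hτ with hτ | hτ
  · exact Or.inl (lt_of_le_of_lt h.2.le (by exact_mod_cast hτ))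
  · exact Or.inr (lt_of_lt_of_le (by exact_mod_cast hτ) h.1.le)

/-! ## §4 The `N`-electron reading -/

/-- **`N`-electron reading** (all three sectors nearly balanced, `|N_α − N_β| ≤ 1`, symmetric files): the three-term bracket
bounds `groundEnergy H_F (a+b) − groundEnergy H_G₁ (a₁+b₁) − groundEnergy H_G₂ (a₂+b₂)` (`Model.groundEnergy_eq_energy_of_le_succ`). -/
theorem Diff3Bracket.groundEnergy_mem_of_le_succ (h : Diff3Bracket F a b G₁ a₁ b₁ G₂ a₂ b₂ lo hi)
    (hF : F.IsSymmetric) (hG₁ : G₁.IsSymmetric) (hG₂ : G₂.IsSymmetric)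
    (hab : a ≤ b + 1) (hba : b ≤ a + 1) (hab₁ : a₁ ≤ b₁ + 1) (hba₁ : b₁ ≤ a₁ + 1)
    (hab₂ : a₂ ≤ b₂ + 1) (hba₂ : b₂ ≤ a₂ + 1) :
    ((lo : ℚ) : ℝ) ≤ groundEnergy F.hamiltonian (a + b) - groundEnergy G₁.hamiltonian (a₁ + b₁) -
        groundEnergy G₂.hamiltonian (a₂ + b₂) ∧
      groundEnergy F.hamiltonian (a + b) - groundEnergy G₁.hamiltonian (a₁ + b₁) -
        groundEnergy G₂.hamiltonian (a₂ + b₂) ≤ ((hi : ℚ) : ℝ) := by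
  obtain ⟨⟨hFr, h1r, h2r, hlo⟩, ⟨-, -, -, hhi⟩⟩ := h
  rw [Model.groundEnergy_eq_energy_of_le_succ hF hFr.1 hFr.2 hab hba,
    Model.groundEnergy_eq_energy_of_le_succ hG₁ h1r.1 h1r.2 hab₁ hba₁,
    Model.groundEnergy_eq_energy_of_le_succ hG₂ h2r.1 h2r.2 hab₂ hba₂]
  exact ⟨hlo, hhi⟩

/-! ## §5 The STEP-0 test for a direct three-term certificate -/

/-- STEP-0 for a DIRECT three-term certificate `[lo′, hi′]` against the absolutes: it BEATS the `dE3-from-absolutes` bracket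
iff `hi′ − lo′ < ½ (W_F + W₁ + W₂)` (a decidable predicate on eight rational slots). -/
def Diff3WidthBeatsAbsolutes (lo' hi' loF hiF lo₁ hi₁ lo₂ hi₂ : ℚ) : Prop :=
  hi' - lo' < ((hiF - loF) + (hi₁ - lo₁) + (hi₂ - lo₂)) / 2

/-- The `dE3-from-absolutes` bracket itself never passes its own STEP-0 test (its width IS `W_F + W₁ + W₂ ≥ ½(…)` for consistent slots). -/
theorem not_diff3WidthBeatsAbsolutes_from_absolutes {loF hiF lo₁ hi₁ lo₂ hi₂ : ℚ} (hF : loF ≤ hiF)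
    (h₁ : lo₁ ≤ hi₁) (h₂ : lo₂ ≤ hi₂) :
    ¬ Diff3WidthBeatsAbsolutes (loF - hi₁ - hi₂) (hiF - lo₁ - lo₂) loF hiF lo₁ hi₁ lo₂ hi₂ := by
  unfold Diff3WidthBeatsAbsolutes
  intro h
  linarith

end Summit.Ventures.CertifiedQuantumChemistry

end
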